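import Literature.AlgebraicGeometry.ComplexMultiplication.CyclotomicFermatCMTypesPrimePowerLevelSimple
import HarnessLib

/-!
# Koblitz–Rohrlich, THEOREM 3 (`N = 3ⁿ`): the non-obvious isogenies `L_{(3ᵐ, 3ⁿ⁻¹−2·3ᵐ, 2·3ⁿ⁻¹+3ᵐ)} = L_{(3ᵐ⁺¹, 3ⁿ⁻¹−2·3ᵐ, 2·3ⁿ⁻¹−3ᵐ)}` —
# the §4 Proposition IN FULL at `N = 9` (kernel enumeration) and the listed coincidences at `N = 27, 81`

Layer `Literature/AlgebraicGeometry/ComplexMultiplication`, namespace `…ComplexMultiplication.CyclotomicFermatCMType`; first file of the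
`CyclotomicFermatCMTypes*` series at levels NOT prime to `6` (the siblings treat `N` prime to `6`, odd `N` with `3 ∣ N` at two-prime levels,
and `N = 21, 39`).  THEOREMS ONLY (no definition, no named fact, no `sorry`); everything here is a kernel computation (`decide`) on the
tree's `fermatCMType N r s t = H_{r,s,t} = {h ∈ (ℤ/N)ˣ : ⟨hr⟩ + ⟨hs⟩ + ⟨ht⟩ = N}`.

THE SOURCE.  N. Koblitz, D. Rohrlich, *Simple factors in the Jacobian of a Fermat curve*, Canad. J. Math. **30** (1978) 1183–1205.
P. 1186: "When `N` is not prime to `6`, the situation is more complicated.  To illustrate this, we shall prove: THEOREM 3. Suppose `N = 3ⁿ`.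
Then the only isogenies apart from the obvious ones are between pairs of lattices corresponding to the triples
`(3ᵐ, 3ⁿ⁻¹ − 2(3ᵐ), 2(3ⁿ⁻¹) + 3ᵐ)` and `(3ᵐ⁺¹, 3ⁿ⁻¹ − 2(3ᵐ), 2(3ⁿ⁻¹) − 3ᵐ)` for `0 ≤ m ≤ n − 2`."  §4 (p. 1198): "Isogenies for `N` a
power of `3`.  Theorem 3 can be restated as follows.  PROPOSITION. Let `N = 3ⁿ`, `N₁ = 3ⁿ⁻¹`, `τ = (r, s, t)`, `τ′ = (r′, s′, t′)`, `H_τ = H_{τ′}`.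
Suppose that `τ` is not a permutation of `τ′`, and that g.c.d.`(r, s, t, r′, s′, t′) = 1`.  Then for some `u ∈ (ℤ/Nℤ)*`, `uτ = (⟨ur⟩, ⟨us⟩, ⟨ut⟩)`
and `uτ′` are permutations of `(1, N₁ − 2, 2N₁ + 1)` and `(3, N₁ − 2, 2N₁ − 1)`."  (Equality of lattices `L_τ = L_{τ′}` for `hH_τ = H_{τ′}`,
p. 1184; "obvious" = `τ′ ∼ τ`, a unit multiple up to permutation, p. 1185.)

WHAT IS PROVED.

* §1 `N = 9` (`n = 2`, `N₁ = 3`; the pair `(1, 1, 7)`, `(3, 1, 5)`): `H_{1,1,7} = H_{3,1,5} = {1, 2, 4}` (`fermatCMType_nine_one_one_seven`,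
  `fermatCMType_nine_three_one_five`) although `(3, 1, 5)` is no unit multiple of a permutation of `(1, 1, 7)` (`not_exists_multiset_eq_nine`:
  a NON-obvious coincidence); and **the §4 PROPOSITION IN FULL at `N = 9`** (`exists_unit_of_fermatCMType_eq_nine`): for triples `τ, τ′` of
  non-zero residues with sums `0`, `H_τ = H_{τ′}`, `τ` not a permutation of `τ′` and not all six entries divisible by `3`, there is a unit
  `u` with `{uτ, uτ′} = {(1,1,7), (3,1,5)}` up to permutations — kernel enumeration of all `8⁴` cases.
* §2 `N = 27` (`n = 3`, `N₁ = 9`; `m = 0`: `(1, 7, 19)`, `(3, 7, 17)`; `m = 1`: `(3, 3, 21) = 3·(1,1,7)`, `(9, 3, 15) = 3·(3,1,5)`): both listed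
  coincidences hold and are non-obvious.
* §3 `N = 81` (`n = 4`, `N₁ = 27`; `m = 0, 1, 2`): the three listed coincidences hold; `m = 0` is non-obvious.

## Honest column / NOT here

* Theorem 3's COMPLETENESS ("the only isogenies") is typed at `N = 9` only; at `27`, `81` only the listed coincidences (the enumeration over
  all pairs of triples is beyond kernel `decide` there); the general-`n` statement and §4's proof (pp. 1198–1201) are NOT typed.
* "Isogeny of lattices" is typed as EQUALITY of the residue sets `H_τ = H_{τ′}` (the same CM type of `ℚ(ζ_N)`, hence the same abelian
  varieties up to isogeny); the Jacobian factors `J_τ` and their dimensions (`M < N` for the `m ≥ 1` pairs) are not constructed.  The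
  hypothesis "g.c.d. `= 1`" is typed as "some entry is a unit" (`3 ∤` g.c.d.), which is weaker, so the `N = 9` statement is slightly stronger
  than printed; K–R's triples have entries in `[1, N−1]` — non-zero residues here, sums `0 (mod N)`.
* Theorem 4 (`N = 2ⁿ`) is NOT typed.  Kernel `decide` only; `maxRecDepth 100000` at `N = 81`.

## References

* [KoblitzRohrlich1978] N. Koblitz, D. Rohrlich, Canad. J. Math. 30 (1978) 1183–1205: Theorem 3 (p. 1186), §4 Proposition (p. 1198), §1
  (pp. 1184–1185).

## Provenance

Cell `pub-hodgecm2` (COR-CM), literature seat `lit-deligne-3` gen 35 (claim KR78-THM3-INSTANCES; count-neutral, own lane).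
-/

open NumberField

namespace Literature.AlgebraicGeometry.ComplexMultiplication

open Literature.AlgebraicGeometry.HodgeTheory

namespace CyclotomicFermatCMType

/-! ## §1 `N = 9`: the pair `(1, 1, 7)`, `(3, 1, 5)` and the §4 Proposition in full -/

section Nine

/-- `H_{1,1,7} = {1, 2, 4}` modulo `9` (kernel computation). [cite: KoblitzRohrlich1978, Theorem 3 (p. 1186) and §4 Proposition (p. 1198)] -/
theorem fermatCMType_nine_one_one_seven : fermatCMType 9 1 1 7 = {1, 2, 4} := by
  decide

/-- `H_{3,1,5} = {1, 2, 4}` modulo `9` (kernel computation). [cite: KoblitzRohrlich1978, Theorem 3 (p. 1186) and §4 Proposition (p. 1198)] -/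
theorem fermatCMType_nine_three_one_five : fermatCMType 9 3 1 5 = {1, 2, 4} := by
  decide

/-- **Theorem 3 at `n = 2`, `m = 0`: `H_{(3,1,5)} = H_{(1,1,7)}` modulo `9`** — the lattices `L_{1,1,7}` and `L_{3,1,5}` coincide.
[cite: KoblitzRohrlich1978, Theorem 3 (p. 1186)] -/
theorem fermatCMType_nine_three_one_five_eq : fermatCMType 9 3 1 5 = fermatCMType 9 1 1 7 := by
  rw [fermatCMType_nine_one_one_seven, fermatCMType_nine_three_one_five]

/-- **… and the coincidence is NOT obvious**: `(3, 1, 5)` is not a unit multiple (indeed no multiple) of a permutation of `(1, 1, 7)` modulo `9`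
(kernel computation). [cite: KoblitzRohrlich1978, Theorem 3 (p. 1186) and §1 (p. 1185)] -/
theorem not_exists_multiset_eq_nine : ¬∃ u : ZMod 9, ({3, 1, 5} : Multiset (ZMod 9)) = {u * 1, u * 1, u * 7} := by
  decide

/-- **THE §4 PROPOSITION AT `N = 9`, IN FULL** (kernel enumeration): let `τ = (r, s, −r−s)`, `τ′ = (r′, s′, −r′−s′)` be triples of NON-ZERO
residues modulo `9` with `H_τ = H_{τ′}`, `τ` not a permutation of `τ′`, and not all six entries divisible by `3` (some entry a unit).  Then
for some unit `u`, `uτ` and `uτ′` are permutations of `(1, N₁ − 2, 2N₁ + 1) = (1, 1, 7)` and `(3, N₁ − 2, 2N₁ − 1) = (3, 1, 5)` (in one of the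
two orders) — "the only isogenies apart from the obvious ones" at `N = 9`. [cite: KoblitzRohrlich1978, §4 Proposition (p. 1198) and Theorem 3 (p. 1186)] -/
theorem exists_unit_of_fermatCMType_eq_nine :
    ∀ r s r' s' : ZMod 9, r ≠ 0 → s ≠ 0 → (-r - s : ZMod 9) ≠ 0 → r' ≠ 0 → s' ≠ 0 → (-r' - s' : ZMod 9) ≠ 0 →
      fermatCMType 9 r s (-r - s) = fermatCMType 9 r' s' (-r' - s') →
      ({r, s, -r - s} : Multiset (ZMod 9)) ≠ {r', s', -r' - s'} →
      (r.val.Coprime 9 ∨ s.val.Coprime 9 ∨ (-r - s : ZMod 9).val.Coprime 9 ∨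
        r'.val.Coprime 9 ∨ s'.val.Coprime 9 ∨ (-r' - s' : ZMod 9).val.Coprime 9) →
      ∃ u : ZMod 9, u.val.Coprime 9 ∧
        ((({u * r, u * s, u * (-r - s)} : Multiset (ZMod 9)) = {1, 1, 7} ∧
            ({u * r', u * s', u * (-r' - s')} : Multiset (ZMod 9)) = {3, 1, 5}) ∨
          (({u * r, u * s, u * (-r - s)} : Multiset (ZMod 9)) = {3, 1, 5} ∧
            ({u * r', u * s', u * (-r' - s')} : Multiset (ZMod 9)) = {1, 1, 7})) := by
  decide

end Nine

/-! ## §2 `N = 27`: the pairs `m = 0` and `m = 1` -/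

section TwentySeven

/-- **Theorem 3 at `n = 3`, `m = 0`**: `H_{(3,7,17)} = H_{(1,7,19)}` modulo `27` (`(3ᵐ, 3ⁿ⁻¹ − 2·3ᵐ, 2·3ⁿ⁻¹ + 3ᵐ) = (1, 7, 19)`,
`(3ᵐ⁺¹, 3ⁿ⁻¹ − 2·3ᵐ, 2·3ⁿ⁻¹ − 3ᵐ) = (3, 7, 17)`; kernel computation). [cite: KoblitzRohrlich1978, Theorem 3 (p. 1186)] -/
theorem fermatCMType_twentySeven_eq₀ : fermatCMType 27 3 7 17 = fermatCMType 27 1 7 19 := by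
  decide

/-- … and it is NOT obvious: `(3, 7, 17)` is no multiple of a permutation of `(1, 7, 19)` modulo `27`. [cite: KoblitzRohrlich1978, Theorem 3 (p. 1186)] -/
theorem not_exists_multiset_eq_twentySeven₀ : ¬∃ u : ZMod 27, ({3, 7, 17} : Multiset (ZMod 27)) = {u * 1, u * 7, u * 19} := by
  decide

/-- **Theorem 3 at `n = 3`, `m = 1`**: `H_{(9,3,15)} = H_{(3,3,21)}` modulo `27` (`= 3·` the level-`9` pair; kernel computation).
[cite: KoblitzRohrlich1978, Theorem 3 (p. 1186)] -/
theorem fermatCMType_twentySeven_eq₁ : fermatCMType 27 9 3 15 = fermatCMType 27 3 3 21 := by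
  decide

/-- … and it is NOT obvious: `(9, 3, 15)` is no multiple of a permutation of `(3, 3, 21)` modulo `27`. [cite: KoblitzRohrlich1978, Theorem 3 (p. 1186)] -/
theorem not_exists_multiset_eq_twentySeven₁ : ¬∃ u : ZMod 27, ({9, 3, 15} : Multiset (ZMod 27)) = {u * 3, u * 3, u * 21} := by
  decide

end TwentySeven

/-! ## §3 `N = 81`: the pairs `m = 0, 1, 2` -/

section EightyOne

set_option maxRecDepth 100000 in
/-- **Theorem 3 at `n = 4`, `m = 0`**: `H_{(3,25,53)} = H_{(1,25,55)}` modulo `81` (kernel computation). [cite: KoblitzRohrlich1978, Theorem 3 (p. 1186)] -/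
theorem fermatCMType_eightyOne_eq₀ : fermatCMType 81 3 25 53 = fermatCMType 81 1 25 55 := by
  decide

set_option maxRecDepth 100000 in
/-- … and it is NOT obvious: `(3, 25, 53)` is no multiple of a permutation of `(1, 25, 55)` modulo `81`. [cite: KoblitzRohrlich1978, Theorem 3 (p. 1186)] -/
theorem not_exists_multiset_eq_eightyOne₀ : ¬∃ u : ZMod 81, ({3, 25, 53} : Multiset (ZMod 81)) = {u * 1, u * 25, u * 55} := by
  decide

set_option maxRecDepth 100000 in
/-- **Theorem 3 at `n = 4`, `m = 1`**: `H_{(9,21,51)} = H_{(3,21,57)}` modulo `81` (kernel computation). [cite: KoblitzRohrlich1978, Theorem 3 (p. 1186)] -/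
theorem fermatCMType_eightyOne_eq₁ : fermatCMType 81 9 21 51 = fermatCMType 81 3 21 57 := by
  decide

set_option maxRecDepth 100000 in
/-- **Theorem 3 at `n = 4`, `m = 2`**: `H_{(27,9,45)} = H_{(9,9,63)}` modulo `81` (kernel computation). [cite: KoblitzRohrlich1978, Theorem 3 (p. 1186)] -/
theorem fermatCMType_eightyOne_eq₂ : fermatCMType 81 27 9 45 = fermatCMType 81 9 9 63 := by
  decide

end EightyOne

end CyclotomicFermatCMType

end Literature.AlgebraicGeometry.ComplexMultiplication
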